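import Summits.CriticalPhenomena.PercolationContinuityZ3.Theorems.FK.Transplant.FHInfiniteVolumeLadder
import Summits.CriticalPhenomena.PercolationContinuityZ3.Theorems.FK.Transplant.FHSlabPercolation
import Literature.Barriers.CriticalPhenomena.RandomClusterFirstOrderNarrowProofs
import Literature.Probability.LatticeModels.FKIsingWiredCriticalPoint
import HarnessLib

/-!
# Binder 1 at infinite volume, AT the critical point: the wired twin at `q = 2` versus large `q`

Registered R106 (cell INBOX l.7100, 2026-08-25); registry row T1j, slot D (ADDENDUM 3 l.7074); label T1j-D (coordinator fk-4 g217; the lead may restyle the label on its record line).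
**CONDITIONAL sub-cell (FH AND TP_FK open at the same `p` for `q > 1` near `p_c(q)`; ⇔ GRC Conj. (5.103)
via K1); the transplant is a typed reduction, not a proof of FK continuity.** Builds on p205010 (kernel
theorem, internal audit signed; external expert review pending). Barrier note cited first (FBN-01):
`Literature.Barriers.CriticalPhenomena.SamePFreeBoundaryCriteria`; calibration K1 verbatim:
"[C3a ∀ p > p_c(q)] ∧ C3b ⇒ p̂_c(q) = p_c(q) = GRC Conj (5.103) = DT Question 5 (open for q ∈ (1,2))".
THIS FILE DOES NOT CHANGE THAT. Calibration leaf X of binder 1, fourth file: where the WIRED-box twin of binder 1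
(leaf X-B/C: `⟺ θ¹(p,q) > 0`) and binder 1 itself part ways. Every `FH` statement below is an `↔` / `¬` at
`q = 2` under the DISPLAYED named fact `Bodineau2005_slabThreshold` (T1s-B's `fh_two_iff_rcCriticalProb_lt`) or a
NEGATION (T1c); `FH` is never discharged for `q > 1` at any `p`; `KNFreeTargetHittable` / `UFSC0` do not occur;
not a re-cut, not `_r4`.

* `q = 2`, `d ≥ 3` (the FK–Ising point; Aizenman–Duminil-Copin–Sidoravicius: `θ¹(p_c(2), 2) = 0`, tree
  `thetaWired_rcCriticalProb_two_eq_zero`): **`forall_qfList_wiredBox_hittable_two_iff`** — the wired twin of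
  binder 1 at `(p, 2)` holds iff `p > p_c(2)`; it FAILS at `p_c(2)` (`not_forall_qfList_wiredBox_hittable_two_at_critical`)
  exactly like binder 1 (`not_fh_two_at_critical`, T1c); and under Bodineau's slab-threshold theorem (displayed
  hypothesis `hB`, as in T1s-B/T1h) **`forall_qfList_wiredBox_hittable_two_iff_fh_two`**: wired twin ⟺ `FH d 2 p` at
  EVERY `p < 1` — at `q = 2` binder 1 is INSENSITIVE to the boundary condition of the box.
* large `q`, `d ≥ 2` (first-order regime; Laanait–Messager–Miracle-Solé–Ruiz–Shlosman = Grimmett Thm. (7.33)(b),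
  tree theorem `RandomClusterFirstOrderNarrow_holds`: `θ⁰(p_c(q), q) = 0 < θ¹(p_c(q), q)` for `q > Q(d)`):
  **`wiredBox_hittable_and_not_fh_at_critical_of_large_q`** — AT `p_c(q)` the wired twin of binder 1 HOLDS while
  binder 1 FAILS: in the first-order regime binder 1 is DECIDED BY the boundary condition of the box.

So the free boundary condition in binder 1 — its only content beyond `θ⁰ > 0` (leaf X-B) — is immaterial at the
Ising point and decisive at a first-order point; the cell's restriction to `q ∈ [1, 2]` is where the two readings
are expected to agree (K1). 0 defs · 0 named facts introduced · 0 sorries · standard axioms.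

## References

* M. Aizenman, H. Duminil-Copin, V. Sidoravicius, Comm. Math. Phys. 334 (2015), Thm. 1.2, Cor. 1.5(1)
  [AizenmanDuminilCopinSidoraviciusCMP2015].
* T. Bodineau, Probab. Theory Related Fields 132 (2005), Thm. 1.1 [Bodineau2005].
* G. Grimmett, *The Random-Cluster Model*, Springer 2006, §5.1 (5.1)–(5.4), Thm. (5.104), Conj. (5.103),
  Thm. (7.33)(b) [Grimmett2006].
* G. Kozma, S. Nitzan, arXiv:2401.12397 (2024), §4 Lemma 9 (p. 16) [KozmaNitzan2024].
-/

noncomputable section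

open MeasureTheory Filter
open scoped ENNReal Topology

namespace Summit.CriticalPhenomena.PercolationContinuityZ3.Theorems.FK

open Literature.Probability.Percolation Literature.Probability.LatticeModels
open Literature.Probability.Percolation.KozmaNitzan Literature.Barriers.CriticalPhenomena

variable {d : ℕ} {p : ℝ}

/-! ## 1. The FK–Ising point `q = 2`, `d ≥ 3` -/

/-- **`q = 2`, `d ≥ 3`: the wired-box twin of binder 1 holds at `(p, 2)` iff `p > p_c(2)`** (`0 ≤ p < 1`): leaf X's
`⟺ θ¹(p,2) > 0`, `θ¹(p_c(2), 2) = 0` (Aizenman–Duminil-Copin–Sidoravicius, tree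
`thetaWired_rcCriticalProb_two_eq_zero`) and monotonicity of `θ¹` in `p`.
[cite: AizenmanDuminilCopinSidoraviciusCMP2015, Thm. 1.2, Cor. 1.5(1); Grimmett2006, §5.1 (5.2)–(5.4)] -/
theorem forall_qfList_wiredBox_hittable_two_iff (hd : 3 ≤ d) (hp : p ∈ Set.Icc (0 : ℝ) 1) (hp1 : p < 1) :
    (∀ g ∈ qfList d, ∀ ε : ℝ, 0 < ε → ∃ k ℓ₀ : ℕ, ∀ m, k ≤ m → ∀ ℓ, ℓ₀ ≤ ℓ →
      1 - ε < regionWiredReal d p 2 (g.Qset ℓ 0) (linkIn (↑(g.Qset ℓ 0)) (GM.ball 0 m) (g.Fset ℓ 0))) ↔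
    rcCriticalProb d 2 < p := by
  haveI : NeZero d := ⟨by omega⟩
  have h2 : (1 : ℝ) ≤ 2 := by norm_num
  rw [forall_qfList_wiredBox_hittable_iff_thetaWired_pos hp hp1 h2]
  refine ⟨fun hθ => ?_, fun hpc => (thetaFree_pos_of_rcCriticalProb_lt h2 hp hpc).trans_le
    (thetaFree_le_thetaWired hp h2)⟩
  by_contra hle
  push Not at hle
  have hmono := thetaWired_mono_left d hp (rcCriticalProb_mem_Icc d 2) hle h2
  rw [thetaWired_rcCriticalProb_two_eq_zero hd] at hmono
  exact absurd hmono (not_le.2 hθ)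

/-- **`q = 2`, `d ≥ 3`: the wired-box twin of binder 1 FAILS at `p_c(2)`** — like binder 1 itself (T1c
`not_fh_two_at_critical`): at the critical point of the random-cluster representation of the 3D Ising model no
reading of KN Lemma 9 survives. [cite: AizenmanDuminilCopinSidoraviciusCMP2015, Thm. 1.2, Cor. 1.5(1); KozmaNitzan2024, §4 Lemma 9 (p. 16)] -/
theorem not_forall_qfList_wiredBox_hittable_two_at_critical (hd : 3 ≤ d) :
    ¬ ∀ g ∈ qfList d, ∀ ε : ℝ, 0 < ε → ∃ k ℓ₀ : ℕ, ∀ m, k ≤ m → ∀ ℓ, ℓ₀ ≤ ℓ →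
      1 - ε < regionWiredReal d (rcCriticalProb d 2) 2 (g.Qset ℓ 0)
        (linkIn (↑(g.Qset ℓ 0)) (GM.ball 0 m) (g.Fset ℓ 0)) := fun h =>
  lt_irrefl _ ((forall_qfList_wiredBox_hittable_two_iff hd (rcCriticalProb_mem_Icc d 2)
    (rcCriticalProb_lt_one (by omega) (by norm_num))).1 h)

/-- **`q = 2`, `d ≥ 3`, under Bodineau's slab-threshold theorem (displayed named fact, NOT asserted): binder 1 is
INSENSITIVE to the boundary condition of the box** — for every `p < 1`, the wired-box twin of binder 1 at `(p, 2)`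
holds iff `FH d 2 p` (both iff `p > p_c(2)`: this file and T1s-B `fh_two_iff_rcCriticalProb_lt`).
[cite: Bodineau2005, Thm. 1.1; AizenmanDuminilCopinSidoraviciusCMP2015, Thm. 1.2; Grimmett2006, Thm. (5.104), Conj. (5.103)] -/
theorem forall_qfList_wiredBox_hittable_two_iff_fh_two (hB : Bodineau2005_slabThreshold) (hd : 3 ≤ d)
    (p : unitInterval) (hp1 : (p : ℝ) < 1) :
    (∀ g ∈ qfList d, ∀ ε : ℝ, 0 < ε → ∃ k ℓ₀ : ℕ, ∀ m, k ≤ m → ∀ ℓ, ℓ₀ ≤ ℓ →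
      1 - ε < regionWiredReal d (p : ℝ) 2 (g.Qset ℓ 0) (linkIn (↑(g.Qset ℓ 0)) (GM.ball 0 m) (g.Fset ℓ 0))) ↔
    FH d 2 p := by
  rw [forall_qfList_wiredBox_hittable_two_iff hd ⟨p.2.1, p.2.2⟩ hp1, fh_two_iff_rcCriticalProb_lt hB hd]

/-! ## 2. The first-order regime: large `q`, `d ≥ 2` -/

/-- **Large `q`, `d ≥ 2`: the wired-box twin of binder 1 HOLDS AT the critical point `p_c(q)`** for every
`q > Q(d)` — `θ¹(p_c(q), q) > 0` by the tree's first-order theorem `RandomClusterFirstOrderNarrow_holds`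
(Grimmett Thm. (7.33)(b) / LMMRS 1991) and leaf X-B. [cite: Grimmett2006, Thm. (7.33)(b); KozmaNitzan2024, §4 Lemma 9 (p. 16)] -/
theorem forall_qfList_wiredBox_hittable_at_critical_of_large_q (hd : 2 ≤ d) :
    ∃ Q : ℝ, ∀ q : ℝ, Q < q → 1 ≤ q →
      ∀ g ∈ qfList d, ∀ ε : ℝ, 0 < ε → ∃ k ℓ₀ : ℕ, ∀ m, k ≤ m → ∀ ℓ, ℓ₀ ≤ ℓ →
        1 - ε < regionWiredReal d (rcCriticalProb d q) q (g.Qset ℓ 0)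
          (linkIn (↑(g.Qset ℓ 0)) (GM.ball 0 m) (g.Fset ℓ 0)) := by
  haveI : NeZero d := ⟨by omega⟩
  obtain ⟨Q, hQ⟩ := RandomClusterFirstOrderNarrow_holds d hd
  exact ⟨Q, fun q hQq hq => forall_qfList_wiredBox_hittable_of_thetaWired_pos (rcCriticalProb_mem_Icc d q)
    (rcCriticalProb_lt_one hd hq) hq (hQ q hQq hq).2⟩

/-- **Large `q`, `d ≥ 2`: AT `p_c(q)` the wired-box twin of binder 1 HOLDS while binder 1 FAILS** (T1c
`not_fh_at_critical_of_large_q`: `θ⁰(p_c(q), q) = 0`). In the first-order regime the Kozma–Nitzan hittability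
of the quarter faces at criticality is DECIDED by the boundary condition of the box — the free boundary
condition that distinguishes binder 1 from a theorem is decisive here, immaterial at `q = 2` (§1).
[cite: Grimmett2006, Thm. (7.33)(b), Conj. (5.103); KozmaNitzan2024, §4 Lemma 9 (p. 16)] -/
theorem wiredBox_hittable_and_not_fh_at_critical_of_large_q (hd : 2 ≤ d) :
    ∃ Q : ℝ, ∀ q : ℝ, Q < q → 1 ≤ q →
      (∀ g ∈ qfList d, ∀ ε : ℝ, 0 < ε → ∃ k ℓ₀ : ℕ, ∀ m, k ≤ m → ∀ ℓ, ℓ₀ ≤ ℓ →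
        1 - ε < regionWiredReal d (rcCriticalProb d q) q (g.Qset ℓ 0)
          (linkIn (↑(g.Qset ℓ 0)) (GM.ball 0 m) (g.Fset ℓ 0))) ∧
      ¬ FH d q ⟨rcCriticalProb d q, rcCriticalProb_mem_Icc d q⟩ := by
  obtain ⟨Q₁, hQ₁⟩ := forall_qfList_wiredBox_hittable_at_critical_of_large_q hd
  obtain ⟨Q₂, hQ₂⟩ := not_fh_at_critical_of_large_q hd
  exact ⟨max Q₁ Q₂, fun q hQq hq =>
    ⟨hQ₁ q ((le_max_left _ _).trans_lt hQq) hq, hQ₂ q ((le_max_right _ _).trans_lt hQq) hq⟩⟩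

end Summit.CriticalPhenomena.PercolationContinuityZ3.Theorems.FK

end
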